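import Summits.QuantumFields.GaugeBoot.Rows.GLYZc1D4HCanon1
import Summits.QuantumFields.GaugeBoot.Rows.GLYZc1D4HCanon2
import Summits.QuantumFields.GaugeBoot.Rows.GLYZc1D4HCanon3
import Summits.QuantumFields.GaugeBoot.Rows.GLYZc1D4HCanon4
import Summits.QuantumFields.GaugeBoot.Rows.GLYZc1D4LCanon1
import Summits.QuantumFields.GaugeBoot.Rows.GLYZc1D4LCanon2
import Summits.QuantumFields.GaugeBoot.Rows.GLYZc1D4SCanon1
import Summits.QuantumFields.GaugeBoot.Rows.GLYZc1D4SCanon2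
import HarnessLib

/-!
# Gauge-boot: every RAW block entry of the glyz-c1-rp-4D problems is a labelled variable in expectation

Cell `pub-gaugeboot` (HOME `run/shared/lean/pub/pub-gaugeboot/`), seat lean1 (binding layer for rows C20–C31 = the certified
glyz-c1-rp-4D windows, FANOUT-PLAN A126 (2): label sets, class/witness tables, the reduction identity, soundness, per-β bindings).

HONEST FRAMING (page 1 of every file of this cell): certified bounds on lattice expectations at STATED coupling,
gauge group, dimension and torus size; NOT a mass gap, NOT a continuum limit, NOT a string tension, NOT large `N`.
The venture is explicitly NOT Yang–Mills-summit-bearing (barriers `FixedCouplingUltralocality`,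
`PerturbativeInvisibility`).

Assembles the kernel-checked class tables (`hcanon`, `scanon`, `lcanon` for the stored half `a ≤ b`; the other half by the
symmetry lemmas of `GLYZc1D4Blocks`) into `H_entry` / `site_entry` / `link_entry`: on every torus and at every real `β`,
`⟨W_0(rawH a b)⟩ = y (hcls a b)` etc. (`y v = ⟨W_0(label v)⟩`), and restates the three raw PSD theorems in the problem
VARIABLES (`H_nonneg_label`, `site_nonneg_label`, `link_nonneg_label`) and as `Matrix.PosSemidef` of the class-table matrices
(`rawBlockH/S/L_posSemidef`) — the input of the reduction step `GLYZc1D4Red` (reduced block `k` = `Y_kᵀ·raw·Y_k`).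
-/

noncomputable section

open Literature.MathematicalPhysics.QuantumFieldTheory
open Matrix

namespace Summit.QuantumFields.GaugeBoot

namespace GLYZc1D4

/-- **Every stored entry (`i ≤ j`) of the `H` table canonicalises** (assembly of the range checks). -/
theorem hcanon (i j : Fin 211) (hij : i.val ≤ j.val) : HCanonOK i j := by
  have h0 : 0 ≤ i.val := Nat.zero_le _
  rcases Nat.lt_or_ge i.val 6 with h1 | h1
  · exact hcanon_rows_0_6 i h0 h1 j hij
  rcases Nat.lt_or_ge i.val 12 with h2 | h2
  · exact hcanon_rows_6_12 i h1 h2 j hij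
  rcases Nat.lt_or_ge i.val 18 with h3 | h3
  · exact hcanon_rows_12_18 i h2 h3 j hij
  rcases Nat.lt_or_ge i.val 25 with h4 | h4
  · exact hcanon_rows_18_25 i h3 h4 j hij
  rcases Nat.lt_or_ge i.val 32 with h5 | h5
  · exact hcanon_rows_25_32 i h4 h5 j hij
  rcases Nat.lt_or_ge i.val 39 with h6 | h6
  · exact hcanon_rows_32_39 i h5 h6 j hij
  rcases Nat.lt_or_ge i.val 46 with h7 | h7
  · exact hcanon_rows_39_46 i h6 h7 j hij
  rcases Nat.lt_or_ge i.val 54 with h8 | h8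
  · exact hcanon_rows_46_54 i h7 h8 j hij
  rcases Nat.lt_or_ge i.val 62 with h9 | h9
  · exact hcanon_rows_54_62 i h8 h9 j hij
  rcases Nat.lt_or_ge i.val 70 with h10 | h10
  · exact hcanon_rows_62_70 i h9 h10 j hij
  rcases Nat.lt_or_ge i.val 79 with h11 | h11
  · exact hcanon_rows_70_79 i h10 h11 j hij
  rcases Nat.lt_or_ge i.val 88 with h12 | h12
  · exact hcanon_rows_79_88 i h11 h12 j hij
  rcases Nat.lt_or_ge i.val 98 with h13 | h13
  · exact hcanon_rows_88_98 i h12 h13 j hij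
  rcases Nat.lt_or_ge i.val 109 with h14 | h14
  · exact hcanon_rows_98_109 i h13 h14 j hij
  rcases Nat.lt_or_ge i.val 121 with h15 | h15
  · exact hcanon_rows_109_121 i h14 h15 j hij
  rcases Nat.lt_or_ge i.val 135 with h16 | h16
  · exact hcanon_rows_121_135 i h15 h16 j hij
  rcases Nat.lt_or_ge i.val 152 with h17 | h17
  · exact hcanon_rows_135_152 i h16 h17 j hij
  rcases Nat.lt_or_ge i.val 177 with h18 | h18
  · exact hcanon_rows_152_177 i h17 h18 j hij
  exact hcanon_rows_177_211 i h18 i.isLt j hij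

/-- **Every stored entry (`i ≤ j`) of the `S` table canonicalises** (assembly of the range checks). -/
theorem scanon (i j : Fin 144) (hij : i.val ≤ j.val) : SCanonOK i j := by
  have h0 : 0 ≤ i.val := Nat.zero_le _
  rcases Nat.lt_or_ge i.val 8 with h1 | h1
  · exact scanon_rows_0_8 i h0 h1 j hij
  rcases Nat.lt_or_ge i.val 17 with h2 | h2
  · exact scanon_rows_8_17 i h1 h2 j hij
  rcases Nat.lt_or_ge i.val 26 with h3 | h3
  · exact scanon_rows_17_26 i h2 h3 j hij
  rcases Nat.lt_or_ge i.val 36 with h4 | h4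
  · exact scanon_rows_26_36 i h3 h4 j hij
  rcases Nat.lt_or_ge i.val 47 with h5 | h5
  · exact scanon_rows_36_47 i h4 h5 j hij
  rcases Nat.lt_or_ge i.val 60 with h6 | h6
  · exact scanon_rows_47_60 i h5 h6 j hij
  rcases Nat.lt_or_ge i.val 75 with h7 | h7
  · exact scanon_rows_60_75 i h6 h7 j hij
  rcases Nat.lt_or_ge i.val 94 with h8 | h8
  · exact scanon_rows_75_94 i h7 h8 j hij
  rcases Nat.lt_or_ge i.val 126 with h9 | h9
  · exact scanon_rows_94_126 i h8 h9 j hij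
  exact scanon_rows_126_144 i h9 i.isLt j hij

/-- **Every stored entry (`i ≤ j`) of the `L` table canonicalises** (assembly of the range checks). -/
theorem lcanon (i j : Fin 144) (hij : i.val ≤ j.val) : LCanonOK i j := by
  have h0 : 0 ≤ i.val := Nat.zero_le _
  rcases Nat.lt_or_ge i.val 8 with h1 | h1
  · exact lcanon_rows_0_8 i h0 h1 j hij
  rcases Nat.lt_or_ge i.val 17 with h2 | h2
  · exact lcanon_rows_8_17 i h1 h2 j hij
  rcases Nat.lt_or_ge i.val 26 with h3 | h3
  · exact lcanon_rows_17_26 i h2 h3 j hij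
  rcases Nat.lt_or_ge i.val 36 with h4 | h4
  · exact lcanon_rows_26_36 i h3 h4 j hij
  rcases Nat.lt_or_ge i.val 47 with h5 | h5
  · exact lcanon_rows_36_47 i h4 h5 j hij
  rcases Nat.lt_or_ge i.val 60 with h6 | h6
  · exact lcanon_rows_47_60 i h5 h6 j hij
  rcases Nat.lt_or_ge i.val 75 with h7 | h7
  · exact lcanon_rows_60_75 i h6 h7 j hij
  rcases Nat.lt_or_ge i.val 94 with h8 | h8
  · exact lcanon_rows_75_94 i h7 h8 j hij
  rcases Nat.lt_or_ge i.val 126 with h9 | h9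
  · exact lcanon_rows_94_126 i h8 h9 j hij
  exact lcanon_rows_126_144 i h9 i.isLt j hij

variable (β : ℝ) (L : ℕ) [NeZero L]

/-- **`H` entries are problem variables**: `⟨W_0(rawH a b)⟩ = y (hcls a b)` (every torus, every real `β`). -/
theorem H_entry (a b : Fin 211) : Rung0D4.W β L (rawH a b) = y β L (hcls a b) := by
  rcases Nat.lt_or_ge b.val a.val with hab | hab
  · rw [W_rawH_symm β L b a, hcls_comm, y, ← hcanon b a hab.le, W4_canonW4 β L _ _ (disp_rawH b a)]
  · rw [y, ← hcanon a b hab, W4_canonW4 β L _ _ (disp_rawH a b)]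

/-- **`site1` entries are problem variables**: `⟨W_0(rawS a b)⟩ = y (scls a b)` (every torus, every real `β`). -/
theorem site_entry (a b : Fin 144) : Rung0D4.W β L (rawS a b) = y β L (scls a b) := by
  rcases Nat.lt_or_ge b.val a.val with hab | hab
  · rw [W_rawS_symm β L b a, scls_comm, y, ← scanon b a hab.le, W4_canonW4 β L _ _ (disp_rawS b a)]
  · rw [y, ← scanon a b hab, W4_canonW4 β L _ _ (disp_rawS a b)]

/-- **`link1` entries are problem variables**: `⟨W_0(rawL a b)⟩ = y (lcls a b)` (every torus, every real `β`). -/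
theorem link_entry (a b : Fin 144) : Rung0D4.W β L (rawL a b) = y β L (lcls a b) := by
  rcases Nat.lt_or_ge b.val a.val with hab | hab
  · rw [W_rawL_symm β L b a, lcls_comm, y, ← lcanon b a hab.le, W4_canonW4 β L _ _ (disp_rawL b a)]
  · rw [y, ← lcanon a b hab, W4_canonW4 β L _ _ (disp_rawL a b)]

/-- **The raw `H` block in the problem variables is PSD** (every torus, every real `β`). -/
theorem H_nonneg_label (c : Fin 211 → ℝ) : 0 ≤ ∑ a, ∑ b, c a * c b * y β L (hcls a b) := by
  have h := H_nonneg β L c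
  simp only [H_entry] at h
  exact h

/-- **The raw `site1` block in the problem variables is PSD** (every even torus, every real `β`). -/
theorem site_nonneg_label (hL : Even L) (c : Fin 144 → ℝ) : 0 ≤ ∑ a, ∑ b, c a * c b * y β L (scls a b) := by
  have h := site_nonneg β L hL c
  simp only [site_entry] at h
  exact h

/-- **The raw `link1` block in the problem variables is PSD** (every even torus `L ≥ 4`, every `β ≥ 0`). -/
theorem link_nonneg_label (hL : Even L) (h4 : 4 ≤ L) (hβ : 0 ≤ β) (c : Fin 144 → ℝ) :
    0 ≤ ∑ a, ∑ b, c a * c b * y β L (lcls a b) := by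
  have h := link_nonneg β L hL h4 hβ c
  simp only [link_entry] at h
  exact h

/-- A real matrix whose entries are a symmetric relabelling of a PSD quadratic form is positive semidefinite. -/
theorem posSemidef_of_table {n : ℕ} (cls : ℕ → ℕ → Fin 1079) (hsymm : ∀ i j, cls i j = cls j i)
    (hq : ∀ c : Fin n → ℝ, 0 ≤ ∑ i : Fin n, ∑ j : Fin n, c i * c j * y β L (cls i j)) :
    (Matrix.of fun i j : Fin n => y β L (cls i j)).PosSemidef := by
  refine Matrix.PosSemidef.of_dotProduct_mulVec_nonneg ?_ fun x => ?_
  · ext i j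
    simp only [Matrix.conjTranspose_apply, Matrix.of_apply, star_trivial, hsymm i j]
  · have h := hq x
    simp only [dotProduct, Matrix.mulVec, Matrix.of_apply, star_trivial, Finset.mul_sum] at h ⊢
    exact h.trans_eq (Finset.sum_congr rfl fun i _ => Finset.sum_congr rfl fun j _ => by ring)

/-- The raw `H` block as a matrix of variables. -/
def rawBlockH : Matrix (Fin 211) (Fin 211) ℝ := Matrix.of fun a b => y β L (hcls a b)

/-- The raw `site1` block as a matrix of variables. -/
def rawBlockS : Matrix (Fin 144) (Fin 144) ℝ := Matrix.of fun a b => y β L (scls a b)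

/-- The raw `link1` block as a matrix of variables. -/
def rawBlockL : Matrix (Fin 144) (Fin 144) ℝ := Matrix.of fun a b => y β L (lcls a b)

/-- **The raw `H` block (in the variables, on the torus state) is positive semidefinite.** -/
theorem rawBlockH_posSemidef : (rawBlockH β L).PosSemidef :=
  posSemidef_of_table β L _ hcls_comm (H_nonneg_label β L)

/-- **The raw `site1` block is positive semidefinite** (even `L`). -/
theorem rawBlockS_posSemidef (hL : Even L) : (rawBlockS β L).PosSemidef :=
  posSemidef_of_table β L _ scls_comm (site_nonneg_label β L hL)

/-- **The raw `link1` block is positive semidefinite** (even `L ≥ 4`, `β ≥ 0`). -/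
theorem rawBlockL_posSemidef (hL : Even L) (h4 : 4 ≤ L) (hβ : 0 ≤ β) : (rawBlockL β L).PosSemidef :=
  posSemidef_of_table β L _ lcls_comm (link_nonneg_label β L hL h4 hβ)

end GLYZc1D4

end Summit.QuantumFields.GaugeBoot

end
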